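import Summits.QuantumFields.GaugeBoot.BootstrapReflectionsZd
import Summits.QuantumFields.GaugeBoot.SpaceGroupBootstrapConvergenceZd
import HarnessLib

/-!
# The bootstrap reduced by the full space group `B_d ⋉ ℤ^d` converges to the Gibbs states with the full lattice symmetry; such states exist at every coupling (gauge-boot, L1/L4 supplement)

HONEST FRAMING (cell `pub-gaugeboot`, page 1 of every file): the venture produces certified bounds
on lattice expectations at stated coupling, gauge group, dimension and torus size; NOT a mass gap,
NOT a continuum limit, NOT a string tension; NOT Yang–Mills-summit-bearing (barriers
`FixedCouplingUltralocality`, `PerturbativeInvisibility`). Structural; it certifies no number.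

## Content (`SU(N)` on `ℤ^d`, one-link Wilson boundary actions, any real `β`)

`BootstrapReflectionsZd` defined the level-`n` SDP reduced by translations, axis permutations AND
axis reflections (`fullSymLevelValuesZdSuN`), proved it sound for the Gibbs states invariant under
the full hyperoctahedral space group, and sandwiched it between the levels `n` and `n + 2` of the
reduction without reflections. Here, the limit of the level:

* `isSiteReflectInvariant_of_forall_poly` — reflection invariance of a finite measure from the
  invariance of its polynomial moments;
* ★★★ `fullSymBootstrap_convergence_dlr_suN` / `fullSymLevelValuesZd_hausdorff_suN` — for every
  polynomial `P` and `ε > 0`, for `n` large every fully reduced level-`n` value of `P` is within `ε`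
  of `∫ P dμ` for a Gibbs state `μ` invariant under ALL of `B_d ⋉ ℤ^d`, and every such `∫ P dμ` is a
  fully reduced value at every level: the fully reduced hierarchy converges to exactly the range of
  `P` over the Gibbs states carrying the full lattice symmetry;
* ★★ `exists_dlr_fullSpaceGroupInvariant_suN` — SUCH GIBBS STATES EXIST AT EVERY `β`: the
  `ℤ₂^d`-average of the expectation functional of a translation- and permutation-invariant Gibbs
  state is an untruncated bootstrap solution (right rows from left rows, `BootstrapLinkReversal`),
  still translation and permutation invariant (`ℤ₂^d` is normalised by both), realised by a DLR
  state (`exists_dlr_of_bootstrap_suN`).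

Together with `bootstrap_convergence_dlr_suN` (plain ⟶ all Gibbs states),
`symBootstrap_convergence_dlr_suN` (translations ⟶ homogeneous phases) and
`spaceSymBootstrap_convergence_dlr_suN` this completes the soundness-and-convergence statement for
the symmetry reduction by the whole lattice symmetry group used by Kazakov–Zheng on the infinite
lattice. What this is NOT: whether Gibbs states WITHOUT the full symmetry exist at some `β`
(symmetry breaking — then the reduced and plain limits differ); rates.

References: V. Kazakov, Z. Zheng, arXiv:2203.11360 §3.3; H.-O. Georgii, Gibbs Measures and Phase
Transitions (2011) Ch. 5 (invariant Gibbs measures by averaging). Folklore.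
-/

noncomputable section

open MeasureTheory Filter Topology
open Literature.MathematicalPhysics.QuantumFieldTheory (LatticeRep)
open Literature.Probability.LatticeModels (Site)
open Literature.MathematicalPhysics.QuantumLattice

namespace Summit.QuantumFields.GaugeBoot

section ZdSuN

variable {d : ℕ} (N : ℕ) (β : ℝ)

/-- **Reflection invariance of a measure from invariance of its polynomial moments.** -/
theorem isSiteReflectInvariant_of_forall_poly
    {μ : Measure (LGConfig d (Matrix.specialUnitaryGroup (Fin N) ℂ))} [IsFiniteMeasure μ]
    (h : ∀ (i : Fin d), ∀ a ∈ polyAlgebra (ι := ZdEdge d) (fundamentalLatticeRep N),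
      ∫ U, a (configSiteReflect i U) ∂μ = ∫ U, a U ∂μ)
    (i : Fin d) : μ.map (configSiteReflect i) = μ := by
  refine eq_of_forall_integral_poly_eq (fundamentalLatticeRep N) _ _ fun a ha => ?_
  change ∫ U, a U ∂(μ.map (configSiteReflectMeasurableEquiv (d := d) N i)) = _
  rw [integral_map_equiv]
  exact h i a ha

/-- The family of symmetry maps imposed by the full reduction: translations, axis permutations,
axis reflections. -/
def fullSpaceGroupMaps (d N : ℕ) :
    Set C(LGConfig d (Matrix.specialUnitaryGroup (Fin N) ℂ), LGConfig d (Matrix.specialUnitaryGroup (Fin N) ℂ)) :=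
  ((Set.range fun v : Fin d → ℤ => relabelCM (G := Matrix.specialUnitaryGroup (Fin N) ℂ) (edgeShift v)) ∪
      Set.range fun σ : Equiv.Perm (Fin d) => relabelCM (G := Matrix.specialUnitaryGroup (Fin N) ℂ) (edgePerm σ)) ∪
    Set.range fun i : Fin d => zdSiteReflectCM (G := Matrix.specialUnitaryGroup (Fin N) ℂ) i

/-- Every map of the family preserves the polynomial observables. -/
theorem comp_mem_polyAlgebra_of_mem_fullSpaceGroupMaps
    {R : C(LGConfig d (Matrix.specialUnitaryGroup (Fin N) ℂ), LGConfig d (Matrix.specialUnitaryGroup (Fin N) ℂ))}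
    (hR : R ∈ fullSpaceGroupMaps d N) {a : C(LGConfig d (Matrix.specialUnitaryGroup (Fin N) ℂ), ℝ)}
    (ha : a ∈ polyAlgebra (ι := ZdEdge d) (fundamentalLatticeRep N)) :
    a.comp R ∈ polyAlgebra (ι := ZdEdge d) (fundamentalLatticeRep N) := by
  rcases hR with (⟨v, rfl⟩ | ⟨σ, rfl⟩) | ⟨i, rfl⟩
  · exact comp_relabelCM_mem_polyAlgebra (fundamentalLatticeRep N) _ ha
  · exact comp_relabelCM_mem_polyAlgebra (fundamentalLatticeRep N) _ ha
  · exact comp_zdSiteReflectCM_mem_polyAlgebra i (fundamentalLatticeRep N) ha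

/-- ★★★ **The fully reduced bootstrap on `ℤ^d` converges to the Gibbs states with the full lattice
symmetry.** `SU(N)`, any `d`, any real `β`: for every polynomial observable `P` and `ε > 0` there
is a level `n` such that every value of the level-`n` SDP reduced by translations, axis permutations
AND axis reflections lies within `ε` of `∫ P dμ` for some Gibbs state `μ` invariant under all of
`B_d ⋉ ℤ^d`. [folklore] -/
theorem fullSymBootstrap_convergence_dlr_suN
    {P : C(LGConfig d (Matrix.specialUnitaryGroup (Fin N) ℂ), ℝ)}
    (hP : P ∈ polyAlgebra (ι := ZdEdge d) (fundamentalLatticeRep N)) {ε : ℝ} (hε : 0 < ε) :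
    ∃ n, ∀ t ∈ fullSymLevelValuesZdSuN (d := d) N β n P,
      ∃ μ ∈ ymGibbsMeasures (d := d) (fundamentalRep (Fin N)) β,
        IsZdTranslationInvariant μ ∧ (∀ σ : Equiv.Perm (Fin d), μ.map (relabelConfig (edgePerm σ)) = μ) ∧
          (∀ i : Fin d, μ.map (configSiteReflect i) = μ) ∧ |t - ∫ U, P U ∂μ| ≤ ε := by
  obtain ⟨n, hn⟩ := bootstrap_convergence_invariant (fundamentalLatticeRep N) (suExp_add N)
    (X := fun X : SuGenerator N => (X : Matrix (Fin N) (Fin N) ℂ)) (rho_suExp N)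
    (S := fun e => wilsonBoundaryAction (fundamentalRep (Fin N)) {e}) (β := β)
    (fun e => wilsonBoundaryAction_mem_polyFunctions (fundamentalLatticeRep N) {e})
    (fun n => wordTruncation (ι := ZdEdge d) (fundamentalLatticeRep N) n)
    (fun a ha => eventually_mem_wordTruncation (fundamentalLatticeRep N) ha)
    (fullSpaceGroupMaps d N)
    (fun R hR a ha => comp_mem_polyAlgebra_of_mem_fullSpaceGroupMaps N hR ha)
    hP hε
  refine ⟨n, ?_⟩
  rintro t ⟨φ, hφ, hT, hperm, hrefl, rfl⟩
  obtain ⟨ψ, hψ, hψinv, hclose⟩ := hn φ hφ (by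
    rintro R ((⟨v, rfl⟩ | ⟨σ, rfl⟩) | ⟨i, rfl⟩) a ha
    · exact hT v a (wordTruncation_mono _ (Nat.le_add_right n n) ha)
    · exact hperm σ a (wordTruncation_mono _ (Nat.le_add_right n n) ha)
    · exact hrefl i a (wordTruncation_mono _ (Nat.le_add_right n n) ha))
  obtain ⟨μ, hμ, hψμ⟩ := exists_dlr_of_bootstrap_suN N β hψ.1 hψ.2.1 hψ.2.2
  haveI := hμ.1
  have hmom : ∀ R, R ∈ fullSpaceGroupMaps d N →
      ∀ a ∈ polyAlgebra (ι := ZdEdge d) (fundamentalLatticeRep N), ∫ U, a (R U) ∂μ = ∫ U, a U ∂μ := by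
    intro R hR a ha
    have h2 := hψμ _ (comp_mem_polyAlgebra_of_mem_fullSpaceGroupMaps N hR ha)
    simp only [ContinuousMap.comp_apply] at h2
    rw [← h2, ← hψμ a ha]
    exact hψinv R hR a ha
  refine ⟨μ, hμ, isZdTranslationInvariant_of_forall_poly N (fun v a ha => hmom _ (Or.inl (Or.inl ⟨v, rfl⟩)) a ha),
    isAxisPermInvariant_of_forall_poly N (fun σ a ha => hmom _ (Or.inl (Or.inr ⟨σ, rfl⟩)) a ha),
    isSiteReflectInvariant_of_forall_poly N (fun i a ha => ?_), ?_⟩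
  · have h := hmom _ (Or.inr ⟨i, rfl⟩) a ha
    simp only [zdSiteReflectCM_apply] at h
    exact h
  · rwa [hψμ P hP] at hclose

/-- ★★ **Hausdorff form**: for `n` large the fully reduced level-`n` values of `P` and the
expectations of `P` over the Gibbs states with the full lattice symmetry are within `ε`; every such
expectation IS a fully reduced value at every level. -/
theorem fullSymLevelValuesZd_hausdorff_suN
    {P : C(LGConfig d (Matrix.specialUnitaryGroup (Fin N) ℂ), ℝ)}
    (hP : P ∈ polyAlgebra (ι := ZdEdge d) (fundamentalLatticeRep N)) {ε : ℝ} (hε : 0 < ε) :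
    ∃ n, (∀ t ∈ fullSymLevelValuesZdSuN (d := d) N β n P,
        ∃ μ ∈ ymGibbsMeasures (d := d) (fundamentalRep (Fin N)) β,
          IsZdTranslationInvariant μ ∧ (∀ σ : Equiv.Perm (Fin d), μ.map (relabelConfig (edgePerm σ)) = μ) ∧
            (∀ i : Fin d, μ.map (configSiteReflect i) = μ) ∧ |t - ∫ U, P U ∂μ| ≤ ε) ∧
      ∀ μ ∈ ymGibbsMeasures (d := d) (fundamentalRep (Fin N)) β, IsZdTranslationInvariant μ →
        (∀ σ : Equiv.Perm (Fin d), μ.map (relabelConfig (edgePerm σ)) = μ) →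
          (∀ i : Fin d, μ.map (configSiteReflect i) = μ) →
            ∫ U, P U ∂μ ∈ fullSymLevelValuesZdSuN (d := d) N β n P := by
  obtain ⟨n, hn⟩ := fullSymBootstrap_convergence_dlr_suN N β hP hε
  exact ⟨n, hn, fun μ hμ hT hperm hrefl => dlr_integral_mem_fullSymLevelValuesZd N β n hμ hT hperm hrefl P⟩

/-! ## Gibbs states with the full lattice symmetry exist -/

/-- ★★ **Gibbs states invariant under the full hyperoctahedral space group `B_d ⋉ ℤ^d` exist at
every `β`** (`SU(N)` on `ℤ^d`): the `ℤ₂^d`-average of the expectation functional of a translation-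
and permutation-invariant Gibbs state is an untruncated bootstrap solution (each reflected functional
is one: right rows from left rows), translation and permutation invariant because both normalise
`ℤ₂^d`, reflection invariant by construction, and realised by a DLR state. [cite: Georgii2011,
Ch. 5 (invariant Gibbs measures by averaging over a finite symmetry group)] -/
theorem exists_dlr_fullSpaceGroupInvariant_suN :
    ∃ μ ∈ ymGibbsMeasures (d := d) (fundamentalRep (Fin N)) β,
      IsZdTranslationInvariant μ ∧ (∀ σ : Equiv.Perm (Fin d), μ.map (relabelConfig (edgePerm σ)) = μ) ∧
        ∀ i : Fin d, μ.map (configSiteReflect i) = μ := by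
  obtain ⟨ν, hν, hνT, hνperm⟩ := exists_fullySymmetric_dlr_suN (d := d) N β
  haveI := hν.1
  set φ := expectationFunctional ν with hφdef
  have hφ : IsBootstrapFeasible (fundamentalLatticeRep N) (suExp N)
      (fun e => wilsonBoundaryAction (fundamentalRep (Fin N)) {e}) β
      (polyAlgebra (ι := ZdEdge d) (fundamentalLatticeRep N) : Set _) φ :=
    isBootstrapFeasible_dlr_suN N β hν subset_rfl
  set R : Finset (Fin d) → C(LGConfig d (Matrix.specialUnitaryGroup (Fin N) ℂ),
      LGConfig d (Matrix.specialUnitaryGroup (Fin N) ℂ)) :=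
    fun s => reflectCM (G := Matrix.specialUnitaryGroup (Fin N) ℂ) s with hRdef
  have hψ := isBootstrapFeasible_avgFunctional (fundamentalLatticeRep N) R
    (fun s => isBootstrapFeasible_poly_comp_reflect_suN N β s hφ)
  obtain ⟨μ, hμ, hψμ⟩ := exists_dlr_of_bootstrap_suN N β hψ.1 hψ.2.1 hψ.2.2
  haveI := hμ.1
  -- invariances of `φ` on every observable
  have hφT : ∀ (v : Fin d → ℤ) (x : C(LGConfig d (Matrix.specialUnitaryGroup (Fin N) ℂ), ℝ)),
      φ (x.comp (relabelCM (G := Matrix.specialUnitaryGroup (Fin N) ℂ) (edgeShift v))) = φ x := fun v x => by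
    rw [hφdef, expectationFunctional_apply, expectationFunctional_apply]
    have hmp : MeasurePreserving (configShift (G := Matrix.specialUnitaryGroup (Fin N) ℂ) (-v)) ν ν :=
      ⟨(configShift _).measurable, hνT (-v)⟩
    have h := hmp.integral_comp (configShift (-v)).measurableEmbedding (fun U => x U)
    simp only [ContinuousMap.comp_apply, relabelCM_edgeShift_eq_configShift]
    exact h
  have hφperm : ∀ (σ : Equiv.Perm (Fin d)) (x : C(LGConfig d (Matrix.specialUnitaryGroup (Fin N) ℂ), ℝ)),
      φ (x.comp (relabelCM (G := Matrix.specialUnitaryGroup (Fin N) ℂ) (edgePerm σ))) = φ x := fun σ x => by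
    rw [hφdef, expectationFunctional_apply, expectationFunctional_apply]
    have hmp : MeasurePreserving
        (relabelConfig (G := Matrix.specialUnitaryGroup (Fin N) ℂ) (edgePerm σ⁻¹)) ν ν :=
      ⟨(relabelConfig _).measurable, hνperm σ⁻¹⟩
    have h := hmp.integral_comp (relabelConfig (edgePerm σ⁻¹)).measurableEmbedding (fun U => x U)
    simp only [ContinuousMap.comp_apply, relabelCM_edgePerm_eq_relabelConfig]
    exact h
  have hmom : ∀ (T : C(LGConfig d (Matrix.specialUnitaryGroup (Fin N) ℂ), LGConfig d (Matrix.specialUnitaryGroup (Fin N) ℂ))),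
      (∀ a ∈ polyAlgebra (ι := ZdEdge d) (fundamentalLatticeRep N),
        a.comp T ∈ polyAlgebra (ι := ZdEdge d) (fundamentalLatticeRep N)) →
      (∀ a, avgFunctional R φ (a.comp T) = avgFunctional R φ a) →
      ∀ a ∈ polyAlgebra (ι := ZdEdge d) (fundamentalLatticeRep N), ∫ U, a (T U) ∂μ = ∫ U, a U ∂μ := by
    intro T hT hinv a ha
    have h2 := hψμ _ (hT a ha)
    simp only [ContinuousMap.comp_apply] at h2
    rw [← h2, ← hψμ a ha]
    exact hinv a
  refine ⟨μ, hμ, isZdTranslationInvariant_of_forall_poly N (fun v => hmom _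
      (fun a ha => comp_relabelCM_mem_polyAlgebra (fundamentalLatticeRep N) _ ha) fun a => ?_),
    isAxisPermInvariant_of_forall_poly N (fun σ => hmom _
      (fun a ha => comp_relabelCM_mem_polyAlgebra (fundamentalLatticeRep N) _ ha) fun a => ?_),
    isSiteReflectInvariant_of_forall_poly N (fun i a ha => ?_)⟩
  · -- translations: `Θ_s` normalises them
    rw [avgFunctional_apply, avgFunctional_apply]
    congr 1
    refine Finset.sum_congr rfl fun s _ => ?_
    simp only [hRdef]
    rw [comp_edgeShift_comp_reflectCM]
    exact hφT (zdReflect s v) _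
  · -- permutations: `σ` conjugates `ℤ₂^d`; reindex
    rw [avgFunctional_apply, avgFunctional_apply]
    congr 1
    have h : ∀ s : Finset (Fin d), φ ((a.comp (relabelCM (edgePerm σ))).comp (R s)) =
        φ (a.comp (R (s.map σ.symm.toEmbedding))) := fun s => by
      simp only [hRdef]
      rw [comp_edgePerm_comp_reflectCM]
      exact hφperm σ _
    simp only [h]
    exact Fintype.sum_equiv (Equiv.finsetCongr σ.symm) _ _ fun s => by
      rw [Equiv.finsetCongr_apply]
  · -- reflections: composing with `Θ_i = R {i}` permutes the family
    have h := hmom (zdSiteReflectCM (G := Matrix.specialUnitaryGroup (Fin N) ℂ) i)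
      (fun a ha => comp_zdSiteReflectCM_mem_polyAlgebra i (fundamentalLatticeRep N) ha) (fun a => by
        have h := avgFunctional_comp_eq R (fun δ => exists_equiv_reflectCM_comp δ) φ {i} a
        simp only [hRdef, reflectCM_singleton] at h
        exact h) a ha
    simp only [zdSiteReflectCM_apply] at h
    exact h

/-- ★★ **Corollary: at every `β` the fully reduced SDP is sound for a non-empty set of states, and
its values contain `∫ P dμ` for some Gibbs state `μ` at every level.** -/
theorem exists_dlr_integral_mem_fullSymLevelValuesZd (n : ℕ)
    (P : C(LGConfig d (Matrix.specialUnitaryGroup (Fin N) ℂ), ℝ)) :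
    ∃ μ ∈ ymGibbsMeasures (d := d) (fundamentalRep (Fin N)) β,
      ∫ U, P U ∂μ ∈ fullSymLevelValuesZdSuN (d := d) N β n P := by
  obtain ⟨μ, hμ, hT, hperm, hrefl⟩ := exists_dlr_fullSpaceGroupInvariant_suN (d := d) N β
  exact ⟨μ, hμ, dlr_integral_mem_fullSymLevelValuesZd N β n hμ hT hperm hrefl P⟩

end ZdSuN

end Summit.QuantumFields.GaugeBoot

end
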